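import Mathlib
import HarnessLib
import Literature.MathematicalPhysics.QuantumLattice.HubbardCovarianceCTNormalForm
import Literature.MathematicalPhysics.QuantumLattice.HubbardCTSliceGram
import Literature.MathematicalPhysics.QuantumLattice.HubbardSliceSymbolDifferences
import Summits.HubbardSuperconductivity.HubbardSuperconductivity.Theorems.KLProgrammeKLRegimeSliceSymbolLine
import Summits.HubbardSuperconductivity.HubbardSuperconductivity.Theorems.KLProgrammeH10TwoPointLimitFrameTorusBridge
import Summits.HubbardSuperconductivity.HubbardSuperconductivity.Theorems.KLProgrammeKLRegimeEngineFrameLevelCount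
import Literature.Probability.LatticeModels.SampledSymbolDifferences

/-!
# Route `KLProgramme` — engine support (route (L2), ADDITIVE weight): the counterterm slice symbol ON THE SPACE-TIME DUAL TORUS —
# it is the restriction of Literature's `C²` profile through the frame band, and its pointwise first/second differences in time and
# along integer directions are those of the continuum function (periodicity of `e_K`; no wrap at the Matsubara seam)

Cell `gate-hubbard-kl`, seat hubbard-kl-k3c2-p3 (row «sector-counting import (DR2000 L11/L12) for the leg-dress bar»), for the ENGINE child
stmt-HubbardSuperconductivity-19823 (`stub_engine_step_norms`: the propagator constant `α_n` on an admissible frame).  The zero-seed counterterm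
slice covariance `C^K_{(Λ,Λ′]}` is normal with symbol `(w^K_Λ − w^K_{Λ′})·βL²·(iω + e_K)/(ω² + e_K²)`
(`HubbardCovarianceCTNormalForm.hubbardCovSliceCT_zero_seed`); here

* §1 **`sliceSymbolCT_eq_sliceSymbolFnXi`**, **`hubbardCovSliceCT_eq_normalCovariance_sliceSymbolFnXi`** — that symbol IS
  `Ψ̂_ω(e_K(k⃗)) = sliceSymbolFnXi (βL²) 0 Λ Λ′ ω_i (nambuXiCT L μ K k⃗)` (Literature `HubbardSliceSymbolSmoothMomentum`);
* §2 `frameLevel_toLp_periodic`, `torusCentredMomentum_add_intCast`, **`nambuXiCT_add_natMul_intCast`** — the frame band at a translate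
  `k⃗ + j·r̄` of a torus momentum by an integer vector `r` is the continuum band `frameLevel μ K` at `c(k⃗) + j·(2π/L)r`
  (`nambuXiCT_eq_frameLevel` + `2πℤ²`-periodicity of `ε` and of the frame);
* §3 the symbol transported to the product torus `(ℤ/2M)¹ × (ℤ/L)²`, `q ↦ Ψ̂_{ω(q₁)}(e_K(c(q₂)))` — exactly the symbol produced by
  `HubbardSpaceTimeCharacters.norm_pullback_normalCovariance_le` — has: sup `≤ 4c/Λ` (`norm_sliceSymbolTorus_le`); SPATIAL first/second
  differences along `(0, r̄)` equal to those of `p ↦ Ψ̂_ω(frameLevel μ K p)` along `w = (2π/L)r` (`fwdDiff_iter_space_sliceSymbolTorus_eq`),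
  hence bounded by `KLProgrammeKLRegimeSliceSymbolLine` with ONLY `‖D²e_K‖ ≤ K₂` (**`norm_fwdDiff_two_space_sliceSymbolTorus_le`**,
  `norm_fwdDiff_space_sliceSymbolTorus_le`; the anisotropic first-order term `|De_K(c(q₂))·w|` explicit); TIME first/second differences
  bounded by `(2π/β)ᵏ × C_k c/Λ^{k+1}` when `Λ′ < π(2M−3)/β` (**`norm_fwdDiff_two_time_sliceSymbolTorus_le`**, `norm_fwdDiff_time_sliceSymbolTorus_le`:
  inside the window the three Matsubara frequencies are consecutive, at the seam all three samples vanish).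

Everything is proved; no definitions, no named facts. [folklore]

References: G. Benfatto, A. Giuliani, V. Mastropietro, Ann. Henri Poincaré 7 (2006) 809–898, (2.36aa), Lemma 2.2 and footnote ¹; M. Salmhofer,
*Renormalization* (1999), §4.2.4–4.2.5 (4.63), (4.70)–(4.71).
-/

noncomputable section

namespace Summit.HubbardSuperconductivity.HubbardSuperconductivity.Theorems.TorusFourierL2

set_option linter.dupNamespace false -- summit = problem name (single-conjunct summit), D-0017

open Set Complex Finset Literature.MathematicalPhysics.QuantumLattice Literature.Probability.LatticeModels
open Summit.HubbardSuperconductivity.HubbardSuperconductivity.Theorems.DispersionFlow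
open Summit.HubbardSuperconductivity.HubbardSuperconductivity.Theorems.PerturbedFermiCurve
open scoped Real

/-! ### §1 The counterterm slice symbol is the restriction of the continuum profile -/

section Restriction

variable {L M : ℕ} [NeZero L]

omit [NeZero L] in
/-- **The zero-seed CT slice symbol at a frequency–momentum is Literature's continuum profile through the frame band**:
`(w^K_Λ(k) − w^K_{Λ′}(k))·(βL²·(iω + e_K)/(ω² + e_K²)) = sliceSymbolFnXi (βL²) 0 Λ Λ′ ω (e_K)` (`β ≠ 0`, so `ω ≠ 0` and the denominators agree).
[cite: Salmhofer1999, §4.2.5 (4.70)] -/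
theorem sliceSymbolCT_eq_sliceSymbolFnXi {β : ℝ} (hβ : β ≠ 0) (μ : ℝ) (K : TrigPolyC4v) (Λ Λ' : ℝ) (k : FreqMomentum L M) :
    ((hubbardCutoffWeightCT L M β μ K Λ k : ℂ) - (hubbardCutoffWeightCT L M β μ K Λ' k : ℂ)) *
        (((β * (L : ℝ) ^ 2 : ℝ) : ℂ) *
          ((Complex.I * matsubaraFreq β M k.1 + nambuXiCT L μ K k.2) / nambuDenCT L M β μ 0 K k)) =
      sliceSymbolFnXi (β * (L : ℝ) ^ 2) 0 Λ Λ' (matsubaraFreq β M k.1) (nambuXiCT L μ K k.2) := by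
  set ω := matsubaraFreq β M k.1 with hω
  set e := nambuXiCT L μ K k.2 with he
  have hω0 : ω ≠ 0 := matsubaraFreq_ne_zero hβ k.1
  have hden : (-I * ((ω + 0 : ℝ) : ℂ) + (e : ℂ)) ≠ 0 := by
    intro h
    have him := congrArg Complex.im h
    simp at him
    exact hω0 him
  have hden2 : ((nambuDenCT L M β μ 0 K k : ℝ) : ℂ) = (-I * ((ω + 0 : ℝ) : ℂ) + (e : ℂ)) * (I * (ω : ℂ) + (e : ℂ)) := by
    rw [nambuDenCT_zero_seed]
    push_cast
    ring_nf
    rw [Complex.I_sq]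
    ring
  rw [sliceSymbolFnXi, sliceWeightFn, resolventFnXi, hubbardCutoffWeightCT, hubbardCutoffWeightCT, hden2]
  have hden' : (I * (ω : ℂ) + (e : ℂ)) ≠ 0 := by
    intro h
    have him := congrArg Complex.im h
    simp at him
    exact hω0 him
  rw [← hω, ← he, add_comm (ω ^ 2) (e ^ 2)]
  field_simp
  push_cast
  ring

/-- **The zero-seed CT slice covariance is normal with symbol `Ψ̂_ω(e_K)`**:
`C^K_{(Λ,Λ′]} = normalCovariance (k, σ) ↦ sliceSymbolFnXi (βL²) 0 Λ Λ′ ω_i (nambuXiCT L μ K k⃗)`. [cite: Salmhofer1999, §4.2.5 (4.70)] -/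
theorem hubbardCovSliceCT_eq_normalCovariance_sliceSymbolFnXi {β : ℝ} (hβ : β ≠ 0) (μ : ℝ) (K : TrigPolyC4v) (Λ Λ' : ℝ) :
    hubbardCovSliceCT L M β μ 0 K Λ Λ' = normalCovariance L M (fun ks =>
      sliceSymbolFnXi (β * (L : ℝ) ^ 2) 0 Λ Λ' (matsubaraFreq β M ks.1.1) (nambuXiCT L μ K ks.1.2)) := by
  rw [hubbardCovSliceCT_zero_seed]
  congr 1
  funext ks
  exact sliceSymbolCT_eq_sliceSymbolFnXi hβ μ K Λ Λ' ks.1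

end Restriction

/-! ### §2 Periodicity: translates of a torus momentum by an integer vector, read through the continuum band -/

section Periodic

variable {L : ℕ} [NeZero L]

/-- The free band is `2πℤ²`-periodic. [folklore] -/
theorem sqDispersion_periodic (p : Fin 2 → ℝ) (m : Fin 2 → ℤ) :
    sqDispersion (fun i => p i + 2 * π * m i) = sqDispersion p := by
  unfold sqDispersion
  have h : ∀ i : Fin 2, Real.cos (p i + 2 * π * m i) = Real.cos (p i) := fun i => by
    rw [show p i + 2 * π * (m i : ℝ) = p i + (m i : ℤ) * (2 * π) by ring, Real.cos_add_int_mul_two_pi]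
  rw [h 0, h 1]

/-- **The frame band is `2πℤ²`-periodic**: `e_K(p + 2πm) = e_K(p)` on `Fin 2 → ℝ` read through `toLp`. [folklore] -/
theorem frameLevel_toLp_periodic (μ : ℝ) (K : TrigPolyC4v) (p : Fin 2 → ℝ) (m : Fin 2 → ℤ) :
    frameLevel μ K (WithLp.toLp 2 (fun i => p i + 2 * π * m i)) = frameLevel μ K (WithLp.toLp 2 p) := by
  rw [frameLevel_toLp, frameLevel_toLp, sqDispersion_periodic, frameShift_toLp_periodic]

/-- **The centred representative of a translate by an integer vector**: for `r : Fin 2 → ℤ` and `y` with `y i = r i (mod L)`,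
`c(k + y) = c(k) + (2π/L)·r + 2π·m` for some `m ∈ ℤ²`. [folklore] -/
theorem torusCentredMomentum_add_intCast (k : TorusSite 2 L) (r : Fin 2 → ℤ) :
    ∃ m : Fin 2 → ℤ, torusCentredMomentum L (k + fun j => ((r j : ℤ) : ZMod L)) =
      fun i => (torusCentredMomentum L k i + 2 * π / L * r i) + 2 * π * m i := by
  have hL : (L : ℝ) ≠ 0 := by exact_mod_cast NeZero.ne L
  -- both sides are `latticeMomentum` up to `2πℤ`; compare the integer representatives modulo `L`
  obtain ⟨m₁, hm₁⟩ := exists_torusCentredMomentum_eq_add L (k + fun j => ((r j : ℤ) : ZMod L))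
  obtain ⟨m₂, hm₂⟩ := exists_torusCentredMomentum_eq_add L k
  -- `val (k i + r i) ≡ val (k i) + r i (mod L)`
  have hdvd : ∀ i : Fin 2, ∃ z : ℤ, (((k + fun j => ((r j : ℤ) : ZMod L)) i).val : ℤ) = ((k i).val : ℤ) + r i + L * z := by
    intro i
    set a : ℤ := (((k + fun j => ((r j : ℤ) : ZMod L)) i).val : ℤ) with ha
    set b : ℤ := ((k i).val : ℤ) + r i with hb
    have h0 : ((a - b : ℤ) : ZMod L) = 0 := by
      rw [ha, hb]
      push_cast
      rw [ZMod.natCast_zmod_val, ZMod.natCast_zmod_val, Pi.add_apply]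
      ring
    obtain ⟨z, hz⟩ := (ZMod.intCast_zmod_eq_zero_iff_dvd (a - b) L).1 h0
    exact ⟨z, by linarith⟩
  choose z hz using hdvd
  refine ⟨fun i => m₁ i - m₂ i + z i, funext fun i => ?_⟩
  rw [hm₁]
  have h2 : torusCentredMomentum L k i = latticeMomentum L k i + 2 * π * m₂ i := by rw [hm₂]
  rw [h2]
  simp only [latticeMomentum]
  have hzi := hz i
  have hcast : ((((k + fun j => ((r j : ℤ) : ZMod L)) i).val : ℕ) : ℝ) = (((k i).val : ℕ) : ℝ) + (r i : ℝ) + (L : ℝ) * (z i : ℝ) := by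
    exact_mod_cast hzi
  rw [hcast]
  push_cast
  field_simp
  ring

/-- **The frame band at a translate of a torus momentum**: for an integer vector `r` and `j : ℕ`,
`nambuXiCT L μ K (k + j • r̄) = frameLevel μ K (toLp (c(k)) + j • toLp ((2π/L)·r))` (`r̄` the reduction of `r` mod `L`). [folklore] -/
theorem nambuXiCT_add_natMul_intCast (μ : ℝ) (K : TrigPolyC4v) (k : TorusSite 2 L) (r : Fin 2 → ℤ) (j : ℕ) :
    nambuXiCT L μ K (k + j • fun i => ((r i : ℤ) : ZMod L)) =
      frameLevel μ K (WithLp.toLp 2 (torusCentredMomentum L k) + (j : ℝ) • WithLp.toLp 2 (fun i => 2 * π / L * (r i : ℝ))) := by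
  have hsmul : (j • fun i => ((r i : ℤ) : ZMod L)) = fun i => (((j * r i : ℤ) : ℤ) : ZMod L) := by
    funext i; simp [nsmul_eq_mul]
  rw [hsmul, nambuXiCT_eq_frameLevel]
  obtain ⟨m, hm⟩ := torusCentredMomentum_add_intCast k (fun i => (j : ℤ) * r i)
  rw [hm, frameLevel_toLp_periodic]
  congr 1
  rw [← WithLp.toLp_smul, ← WithLp.toLp_add]
  congr 1
  funext i
  simp only [Pi.add_apply, Pi.smul_apply, smul_eq_mul]
  push_cast
  ring

end Periodic

/-! ### §3 The slice symbol on the product torus: sup and pointwise differences -/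

section Torus

variable {L M : ℕ} [NeZero L] [NeZero M] {c Λ Λ' β μ : ℝ} {K : TrigPolyC4v}

omit [NeZero L] in
/-- **Sup**: `‖Ψ̂_{ω(q₁)}(e_K(q₂))‖ ≤ 4c/Λ` at every point of the product torus. [cite: BenfattoGiulianiMastropietro2006, §2.5 (2.50)] -/
theorem norm_sliceSymbolTorus_le (hΛ : 0 < Λ) (hΛΛ' : Λ ≤ Λ') (hc : 0 ≤ c) (q : TorusSite 1 (2 * M) × TorusSite 2 L) :
    ‖sliceSymbolFnXi c 0 Λ Λ' (matsubaraFreq β M ⟨(q.1 0).val, ZMod.val_lt (q.1 0)⟩) (nambuXiCT L μ K q.2)‖ ≤ 4 * c / Λ :=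
  norm_sliceSymbolFnXi_le hΛ hΛΛ' hc _

/-- **Spatial differences on the torus are differences of the continuum function**: for an integer vector `r`, every `N`,
`(Δ_{(0,r̄)})ᴺ [q ↦ Ψ̂_{ω(q₁)}(e_K(q₂))] (q) = (Δ_w)ᴺ [p ↦ Ψ̂_{ω(q₁)}(frameLevel μ K p)] (toLp c(q₂))`, `w = toLp ((2π/L)·r)`
(the band and the frame are `2πℤ²`-periodic, so no seam is seen). [folklore] -/
theorem fwdDiff_iter_space_sliceSymbolTorus_eq (r : Fin 2 → ℤ) (N : ℕ) (q : TorusSite 1 (2 * M) × TorusSite 2 L) :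
    ((fwdDiff ((0 : TorusSite 1 (2 * M)), (fun i => ((r i : ℤ) : ZMod L))))^[N]
        (fun q : TorusSite 1 (2 * M) × TorusSite 2 L =>
          sliceSymbolFnXi c 0 Λ Λ' (matsubaraFreq β M ⟨(q.1 0).val, ZMod.val_lt (q.1 0)⟩) (nambuXiCT L μ K q.2))) q =
      ((fwdDiff (WithLp.toLp 2 (fun i => 2 * π / L * (r i : ℝ)) : EuclideanSpace ℝ (Fin 2)))^[N]
        (fun p : EuclideanSpace ℝ (Fin 2) =>
          sliceSymbolFnXi c 0 Λ Λ' (matsubaraFreq β M ⟨(q.1 0).val, ZMod.val_lt (q.1 0)⟩) (frameLevel μ K p)))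
        (WithLp.toLp 2 (torusCentredMomentum L q.2)) := by
  rw [fwdDiff_iter_prod_snd, fwdDiff_iter_eq_sum_shift, fwdDiff_iter_eq_sum_shift]
  refine Finset.sum_congr rfl fun j _ => ?_
  congr 1
  dsimp only
  rw [nambuXiCT_add_natMul_intCast μ K q.2 r j, Nat.cast_smul_eq_nsmul]

/-- **Second spatial difference of the slice symbol on the torus** (only `C²` data of the band): for `e_K = frameLevel μ K` with
`‖D²e_K‖ ≤ K₂` and an integer vector `r` (`w = toLp ((2π/L)·r)`),
`‖(Δ_{(0,r̄)})² Ψ (q)‖ ≤ (32B₂+144B₁+128)(c/Λ³)(|De_K(c(q₂))·w| + 2K₂‖w‖²)² + (16B₁+16)(c/Λ²)K₂‖w‖²`.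
[cite: BenfattoGiulianiMastropietro2006, Lemma 2.2 (2.36aa)] -/
theorem norm_fwdDiff_two_space_sliceSymbolTorus_le {K₂ : ℝ} (hK₂ : ∀ p, ‖iteratedFDeriv ℝ 2 (frameLevel μ K) p‖ ≤ K₂)
    (hΛ : 0 < Λ) (hΛΛ' : Λ ≤ Λ') (hc : 0 ≤ c) {B₁ B₂ : ℝ} (hB₁ : ∀ x, |deriv salmhoferCutoff x| ≤ B₁)
    (hB₂ : ∀ x, |deriv (deriv salmhoferCutoff) x| ≤ B₂) (r : Fin 2 → ℤ) (q : TorusSite 1 (2 * M) × TorusSite 2 L) :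
    ‖((fwdDiff ((0 : TorusSite 1 (2 * M)), (fun i => ((r i : ℤ) : ZMod L))))^[2]
        (fun q : TorusSite 1 (2 * M) × TorusSite 2 L =>
          sliceSymbolFnXi c 0 Λ Λ' (matsubaraFreq β M ⟨(q.1 0).val, ZMod.val_lt (q.1 0)⟩) (nambuXiCT L μ K q.2))) q‖ ≤
      (32 * B₂ + 144 * B₁ + 128) * c / Λ ^ 3 *
          (|fderiv ℝ (frameLevel μ K) (WithLp.toLp 2 (torusCentredMomentum L q.2))
              (WithLp.toLp 2 (fun i => 2 * π / L * (r i : ℝ)))| +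
            2 * (K₂ * ‖(WithLp.toLp 2 (fun i => 2 * π / L * (r i : ℝ)) : EuclideanSpace ℝ (Fin 2))‖ ^ 2)) ^ 2 +
        (16 * B₁ + 16) * c / Λ ^ 2 * (K₂ * ‖(WithLp.toLp 2 (fun i => 2 * π / L * (r i : ℝ)) : EuclideanSpace ℝ (Fin 2))‖ ^ 2) := by
  rw [fwdDiff_iter_space_sliceSymbolTorus_eq]
  exact norm_fwdDiff_two_sliceSymbol_line_le (EngineV8.contDiff_frameLevel μ K) hK₂ hΛ hΛΛ' hc hB₁ hB₂ _ _

/-- **First spatial difference of the slice symbol on the torus**: `‖Δ_{(0,r̄)} Ψ (q)‖ ≤ (16B₁+16)(c/Λ²)(|De_K(c(q₂))·w| + K₂‖w‖²)`.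
[cite: BenfattoGiulianiMastropietro2006, Lemma 2.2 (2.36aa)] -/
theorem norm_fwdDiff_space_sliceSymbolTorus_le {K₂ : ℝ} (hK₂ : ∀ p, ‖iteratedFDeriv ℝ 2 (frameLevel μ K) p‖ ≤ K₂)
    (hΛ : 0 < Λ) (hΛΛ' : Λ ≤ Λ') (hc : 0 ≤ c) {B₁ : ℝ} (hB₁ : ∀ x, |deriv salmhoferCutoff x| ≤ B₁)
    (r : Fin 2 → ℤ) (q : TorusSite 1 (2 * M) × TorusSite 2 L) :
    ‖fwdDiff ((0 : TorusSite 1 (2 * M)), (fun i => ((r i : ℤ) : ZMod L)))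
        (fun q : TorusSite 1 (2 * M) × TorusSite 2 L =>
          sliceSymbolFnXi c 0 Λ Λ' (matsubaraFreq β M ⟨(q.1 0).val, ZMod.val_lt (q.1 0)⟩) (nambuXiCT L μ K q.2)) q‖ ≤
      (16 * B₁ + 16) * c / Λ ^ 2 *
        (|fderiv ℝ (frameLevel μ K) (WithLp.toLp 2 (torusCentredMomentum L q.2)) (WithLp.toLp 2 (fun i => 2 * π / L * (r i : ℝ)))| +
          K₂ * ‖(WithLp.toLp 2 (fun i => 2 * π / L * (r i : ℝ)) : EuclideanSpace ℝ (Fin 2))‖ ^ 2) := by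
  have h := fwdDiff_iter_space_sliceSymbolTorus_eq (c := c) (Λ := Λ) (Λ' := Λ') (β := β) (μ := μ) (K := K) r 1 q
  simp only [Function.iterate_one] at h
  rw [h]
  exact norm_fwdDiff_sliceSymbol_line_le (EngineV8.contDiff_frameLevel μ K) hK₂ hΛ hΛΛ' hc hB₁ _ _

/-- The frequency sample at a product-torus point is the padded frequency `gridFreq` with `N = 2M`. [folklore] -/
theorem matsubaraFreq_val_eq_gridFreq (β : ℝ) (q₀ : TorusSite 1 (2 * M)) :
    matsubaraFreq β M ⟨(q₀ 0).val, ZMod.val_lt (q₀ 0)⟩ = gridFreq M (2 * M) β q₀ :=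
  matsubaraFreq_eq_gridFreq β q₀ _

/-- Beyond the window the sample vanishes: if `Λ′ < π(2M−3)/β` and `val q₀ ≤ 1 ∨ 2M−2 ≤ val q₀`, the symbol at `q₀` is zero. [folklore] -/
theorem sliceSymbolTorus_eq_zero_of_seam (hβ : 0 < β) (hΛ : 0 < Λ) (hΛΛ' : Λ ≤ Λ') (hM : Λ' < π * (2 * M - 3) / β)
    (q₀ : TorusSite 1 (2 * M)) (h : (q₀ 0).val ≤ 1 ∨ 2 * M - 2 ≤ (q₀ 0).val) (ξ : ℝ) :
    sliceSymbolFnXi c 0 Λ Λ' (matsubaraFreq β M ⟨(q₀ 0).val, ZMod.val_lt (q₀ 0)⟩) ξ = 0 := by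
  rw [← sliceSymbolFn_eq_sliceSymbolFnXi, matsubaraFreq_val_eq_gridFreq]
  exact sliceSymbolFn_eq_zero_of_lt hΛ hΛΛ' c ξ (lt_of_lt_of_le hM (abs_gridFreq_ge hβ q₀ h))

omit [NeZero L] in
/-- **Second time difference of the slice symbol on the torus**: for `0 < β`, `0 < Λ ≤ Λ′ < π(2M−3)/β`,
`‖(Δ_{(1,0)})² Ψ (q)‖ ≤ (2π/β)²·(32B₂+144B₁+128)c/Λ³` at EVERY point (inside the window the three frequencies are consecutive
Matsubara frequencies; at the seam all three samples vanish). [cite: BenfattoGiulianiMastropietro2006, (2.36aa)] -/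
theorem norm_fwdDiff_two_time_sliceSymbolTorus_le (hβ : 0 < β) (hΛ : 0 < Λ) (hΛΛ' : Λ ≤ Λ') (hM : Λ' < π * (2 * M - 3) / β)
    (hc : 0 ≤ c) {B₁ B₂ : ℝ} (hB₁ : ∀ x, |deriv salmhoferCutoff x| ≤ B₁) (hB₂ : ∀ x, |deriv (deriv salmhoferCutoff) x| ≤ B₂)
    (q : TorusSite 1 (2 * M) × TorusSite 2 L) :
    ‖((fwdDiff ((fun _ : Fin 1 => (1 : ZMod (2 * M))), (0 : TorusSite 2 L)))^[2]
        (fun q : TorusSite 1 (2 * M) × TorusSite 2 L =>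
          sliceSymbolFnXi c 0 Λ Λ' (matsubaraFreq β M ⟨(q.1 0).val, ZMod.val_lt (q.1 0)⟩) (nambuXiCT L μ K q.2))) q‖ ≤
      (2 * π / β) ^ 2 * ((32 * B₂ + 144 * B₁ + 128) * c / Λ ^ 3) := by
  have hB10 : 0 ≤ B₁ := (abs_nonneg _).trans (hB₁ 0)
  have hB20 : 0 ≤ B₂ := (abs_nonneg _).trans (hB₂ 0)
  rw [fwdDiff_iter_prod_fst, fwdDiff_iter_two_apply]
  set ξ := nambuXiCT L μ K q.2 with hξ
  set u : TorusSite 1 (2 * M) := fun _ => (1 : ZMod (2 * M)) with hu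
  by_cases hin : (q.1 0).val + 2 < 2 * M
  · -- inside the window: three consecutive Matsubara frequencies
    have hfreq : ∀ j : ℕ, j ≤ 2 → matsubaraFreq β M ⟨((q.1 + j • u) 0).val, ZMod.val_lt _⟩ =
        gridFreq M (2 * M) β q.1 + j * (2 * π / β) := by
      intro j hj
      rw [matsubaraFreq_val_eq_gridFreq, hu, gridFreq_add_smul β q.1 j (by omega)]
    have e2 := hfreq 2 le_rfl
    have e1 := hfreq 1 (by norm_num)
    have e0 : matsubaraFreq β M ⟨(q.1 0).val, ZMod.val_lt _⟩ = gridFreq M (2 * M) β q.1 := matsubaraFreq_val_eq_gridFreq β q.1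
    dsimp only
    rw [e2, e1, e0]
    simp only [← sliceSymbolFn_eq_sliceSymbolFnXi]
    have h := norm_fwdDiff_two_sliceSymbol_freq_le (c := c) (ξ := ξ) hΛ hΛΛ' hc hB₁ hB₂ (δ := 2 * π / β) (by positivity)
      (gridFreq M (2 * M) β q.1)
    rw [fwdDiff_iter_two_apply] at h
    have e : gridFreq M (2 * M) β q.1 + 2 • (2 * π / β) = gridFreq M (2 * M) β q.1 + (2 : ℕ) * (2 * π / β) := by
      rw [nsmul_eq_mul]
    have e' : gridFreq M (2 * M) β q.1 + 1 • (2 * π / β) = gridFreq M (2 * M) β q.1 + (1 : ℕ) * (2 * π / β) := by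
      rw [nsmul_eq_mul]
    rw [e, e'] at h
    exact h
  · -- at the seam: all three samples vanish
    have hv0 : 2 * M - 2 ≤ (q.1 0).val := by omega
    have hM2 : 2 ≤ 2 * M := by
      have := ZMod.val_lt (q.1 0); omega
    have hval : ∀ j : ℕ, j ≤ 2 → ((q.1 + j • u) 0).val ≤ 1 ∨ 2 * M - 2 ≤ ((q.1 + j • u) 0).val := by
      intro j hj
      have hv : ((q.1 + j • u) 0).val = ((q.1 0).val + j) % (2 * M) := by
        rw [Pi.add_apply, hu, smul_const_one_apply, ZMod.val_add, ZMod.val_natCast, Nat.add_mod_mod]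
      rw [hv]
      have hlt := ZMod.val_lt (q.1 0)
      by_cases hwrap : (q.1 0).val + j < 2 * M
      · right; rw [Nat.mod_eq_of_lt hwrap]; omega
      · left
        have : (q.1 0).val + j - 2 * M < 2 * M := by omega
        rw [show (q.1 0).val + j = ((q.1 0).val + j - 2 * M) + 2 * M by omega, Nat.add_mod_right,
          Nat.mod_eq_of_lt this]
        omega
    have z2 := sliceSymbolTorus_eq_zero_of_seam (c := c) hβ hΛ hΛΛ' hM (q.1 + 2 • u) (hval 2 le_rfl) ξ
    have z1 := sliceSymbolTorus_eq_zero_of_seam (c := c) hβ hΛ hΛΛ' hM (q.1 + 1 • u) (hval 1 (by norm_num)) ξ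
    have z0 := sliceSymbolTorus_eq_zero_of_seam (c := c) hβ hΛ hΛΛ' hM q.1 (Or.inr hv0) ξ
    dsimp only
    rw [z2, z1, z0]
    simp only [smul_zero, sub_zero, add_zero, norm_zero]
    positivity

omit [NeZero L] in
/-- **First time difference of the slice symbol on the torus**: `‖Δ_{(1,0)} Ψ (q)‖ ≤ (2π/β)·(16B₁+16)c/Λ²` (`Λ′ < π(2M−3)/β`).
[cite: BenfattoGiulianiMastropietro2006, (2.36aa)] -/
theorem norm_fwdDiff_time_sliceSymbolTorus_le (hβ : 0 < β) (hΛ : 0 < Λ) (hΛΛ' : Λ ≤ Λ') (hM : Λ' < π * (2 * M - 3) / β)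
    (hc : 0 ≤ c) {B₁ : ℝ} (hB₁ : ∀ x, |deriv salmhoferCutoff x| ≤ B₁) (q : TorusSite 1 (2 * M) × TorusSite 2 L) :
    ‖fwdDiff ((fun _ : Fin 1 => (1 : ZMod (2 * M))), (0 : TorusSite 2 L))
        (fun q : TorusSite 1 (2 * M) × TorusSite 2 L =>
          sliceSymbolFnXi c 0 Λ Λ' (matsubaraFreq β M ⟨(q.1 0).val, ZMod.val_lt (q.1 0)⟩) (nambuXiCT L μ K q.2)) q‖ ≤
      (2 * π / β) * ((16 * B₁ + 16) * c / Λ ^ 2) := by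
  have hB10 : 0 ≤ B₁ := (abs_nonneg _).trans (hB₁ 0)
  have h1 := fwdDiff_iter_prod_fst (fun q : TorusSite 1 (2 * M) × TorusSite 2 L =>
      sliceSymbolFnXi c 0 Λ Λ' (matsubaraFreq β M ⟨(q.1 0).val, ZMod.val_lt (q.1 0)⟩) (nambuXiCT L μ K q.2))
    (fun _ : Fin 1 => (1 : ZMod (2 * M))) 1 q
  simp only [Function.iterate_one] at h1
  rw [h1, fwdDiff]
  set ξ := nambuXiCT L μ K q.2 with hξ
  set u : TorusSite 1 (2 * M) := fun _ => (1 : ZMod (2 * M)) with hu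
  by_cases hin : (q.1 0).val + 1 < 2 * M
  · have e1 : matsubaraFreq β M ⟨((q.1 + u) 0).val, ZMod.val_lt _⟩ = gridFreq M (2 * M) β q.1 + 1 * (2 * π / β) := by
      rw [matsubaraFreq_val_eq_gridFreq, show q.1 + u = q.1 + 1 • u by rw [one_smul], hu, gridFreq_add_smul β q.1 1 (by omega)]
      norm_num
    have e0 : matsubaraFreq β M ⟨(q.1 0).val, ZMod.val_lt _⟩ = gridFreq M (2 * M) β q.1 := matsubaraFreq_val_eq_gridFreq β q.1
    rw [e1, e0, one_mul]
    simp only [← sliceSymbolFn_eq_sliceSymbolFnXi]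
    have h := norm_fwdDiff_sliceSymbol_freq_le (c := c) (ξ := ξ) hΛ hΛΛ' hc hB₁ (δ := 2 * π / β) (by positivity)
      (gridFreq M (2 * M) β q.1)
    rw [fwdDiff] at h
    exact h
  · have hv0 : 2 * M - 2 ≤ (q.1 0).val := by omega
    have hv1 : ((q.1 + u) 0).val ≤ 1 ∨ 2 * M - 2 ≤ ((q.1 + u) 0).val := by
      have hlt := ZMod.val_lt (q.1 0)
      have hv : ((q.1 + u) 0).val = ((q.1 0).val + 1) % (2 * M) := by
        rw [Pi.add_apply, hu, ZMod.val_add, ZMod.val_one_eq_one_mod, Nat.add_mod_mod]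
      rw [hv]
      left
      have heq : (q.1 0).val + 1 = 2 * M := by omega
      rw [heq, Nat.mod_self]
      omega
    have z1 := sliceSymbolTorus_eq_zero_of_seam (c := c) hβ hΛ hΛΛ' hM (q.1 + u) hv1 ξ
    have z0 := sliceSymbolTorus_eq_zero_of_seam (c := c) hβ hΛ hΛΛ' hM q.1 (Or.inr hv0) ξ
    rw [z1, z0, sub_zero, norm_zero]
    positivity

end Torus

end Summit.HubbardSuperconductivity.HubbardSuperconductivity.Theorems.TorusFourierL2

end
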